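import Mathlib
import HarnessLib
import Summits.ValiantsHypothesis.ValiantsHypothesis.Theses.MonotoneRestoration
import Literature.Computability.AlgebraicComplexity.ArithCircuit
import Literature.Computability.AlgebraicComplexity.ArithCircuitProofs
import Literature.Computability.AlgebraicComplexity.MonotoneStructure
import Literature.Computability.AlgebraicComplexity.PermanentIrreducible
import Literature.ModelTheory.FiniteModelTheory.CkEquiv
import Summits.ValiantsHypothesis.ValiantsHypothesis.Theorems.MonotoneRestorationMonotoneRestorationQPCosetCount
import Summits.ValiantsHypothesis.ValiantsHypothesis.Theorems.MonotoneRestorationMonotoneRestorationQPSymmetricLB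
import Summits.ValiantsHypothesis.ValiantsHypothesis.Theorems.MonotoneRestorationMonotoneRestorationQPSupportSymmetrisation
import Summits.ValiantsHypothesis.ValiantsHypothesis.Theorems.MonotoneRestorationMonotoneRestorationQPSparseRegime
import Summits.ValiantsHypothesis.ValiantsHypothesis.Theorems.MonotoneRestorationMonotoneRestorationQPBeta
import Literature.Computability.AlgebraicComplexity.SymmetricArithCircuit
import Literature.Computability.AlgebraicComplexity.DawarWilsenach2025Proofs
import Literature.GroupTheory.PermutationGroups.SmallIndexSubgroups
import Summits.ValiantsHypothesis.ValiantsHypothesis.Theorems.MonotoneRestorationQP.Negative.LoadBearing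
import Summits.ValiantsHypothesis.ValiantsHypothesis.Theorems.MonotoneRestorationMonotoneRestorationQPPermSupportCount

/-! TTRL-lite variant V21333 of stmt-ValiantsHypothesis-15886 -/

namespace Summit.ValiantsHypothesis.ValiantsHypothesis.Theorems

open Summit.ValiantsHypothesis.ValiantsHypothesis.Theses.MonotoneRestoration
open Literature.Computability.AlgebraicComplexity

/-- TTRL-lite variant V21333 (`lemma_proposal`) of `stub_symmetricMonotone_choose_le_card`
(`stmt-ValiantsHypothesis-15886`): the pure arithmetic certificate that the
parameter regime `2 ≤ k`, `k * k ≤ d`, `d + k + 9 ≤ n` already forces the side conditions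
`8 < n`, `4 * k ≤ n`, `3 * k ≤ d + 2` and `d + k ≤ n` used by the in-tree linear form
(`k² - 3k + 2 = (k-1)(k-2) ≥ 0` and `k² + k + 9 ≥ 4k`). -/
theorem stub_symmetricMonotone_choose_le_card_var21333 :
    ∀ n d k : ℕ, 2 ≤ k → k * k ≤ d → d + k + 9 ≤ n →
      8 < n ∧ 4 * k ≤ n ∧ 3 * k ≤ d + 2 ∧ d + k ≤ n := by
  intro n d k hk hkd hdk
  have hsq : 3 * k ≤ k * k + 2 := by
    rcases Nat.lt_or_ge k 3 with h | h
    · obtain rfl : k = 2 := by omega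
      norm_num
    · have h3 : 3 * k ≤ k * k := Nat.mul_le_mul_right k h
      omega
  refine ⟨by omega, by omega, by omega, by omega⟩

end Summit.ValiantsHypothesis.ValiantsHypothesis.Theorems
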